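import Mathlib
import HarnessLib
import Summits.AtomisticToContinuum.FouriersLaw.Theses.HoelderEscapeProfile

/-!
# Birth skeleton (BC3) for crux `HoelderEscapeProfile.LocalEnergyHalfHoelder`
(item `stmt-AtomisticToContinuum-16008`, route `route-AtomisticToContinuum-HoelderEscapeProfile`, crux rank 2;
sub-problem `FouriersLaw`; registrar `planner-skel-stmt-AtomisticToContinuum-16008-0`, 2026-08-17)

Crux (FIXED, concluded BY NAME below): for `pinnedChain ω₂ lam β γ` (`ω₂, lam, β > 0`, any `γ`), every
`T > 0`, every guarded pair (`μ` = shift- and momentum-reversal-invariant Gibbs state at `T`, `D` = a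
`μ`-preserving `InfiniteChainDynamics` commuting with the shift a.e.), the split-bond site energy `h` and
its on-site autocorrelation `S 0 t = Cov_μ(h_0, h_0 ∘ φ_t)`: if `e^{-νt} S(0,t)` is integrable on `(0,∞)`
for every `ν > 0`, then `∃ C ν₀ > 0, ∀ 0 < ν ≤ ν₀, Ψ(ν) := ν∫₀^∞ e^{-νt} S(0,t) dt ≤ C√ν`
(the Abel-mean on-site return of the local energy is `O(√ν)`: the site-energy spectral measure is ½-Hölder at 0).

## Line `birth` — MEAN-ERGODIC RATE (time domain, Fejér form) × SECOND-ORDER ABELIAN LEMMA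

The route's own two-layer plan ("LocalEnergyHalfHoelder ⇐ DyadicReturnBound → AbelFromCesaro") in its
WEAKEST one-sided form.  Write `J(t) := ∫₀ᵗ (t − s) S(0,s) ds` (second primitive of the on-site
autocorrelation).  For the guarded pair, `2J(t)/t² = ‖(1/t)∫₀ᵗ (h_0∘φ_s − ⟨h_0⟩) ds‖²_{L²(μ)}` is the
VARIANCE OF THE TIME-AVERAGED LOCAL ENERGY (Fejér mean of `S(0,·)`), a manifestly non-negative quantity.

* `stub_meanErgodicRate` (DYNAMICS, the load-bearing stub): under the crux's hypotheses verbatim,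
  `∃ C t₀ > 0, ∀ t ≥ t₀, J(t) ≤ C·t√t` — the time-averaged site energy equilibrates in `L²(μ_T)` at rate
  `t^{-1/4}` (variance `≤ 2C t^{-1/2}`), i.e. the local energy fluctuation returns at least diffusively
  fast IN FEJÉR MEAN.  Diffusive calibration `S(0,s) ≈ χ(4πDs)^{-1/2}` gives `J(t) ≈ (2χ/3)(πD)^{-1/2} t^{3/2}`
  (exponent sharp); the harmonic corner (`S(0,s) ≍ 1/s`, `J ≍ t log t`) satisfies it with room (ballistic
  transport returns FASTER — the barrier `HarmonicChainBallisticFlux` is met by the route's finiteness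
  crux `AbelSpreadCeiling`, not here); it FAILS exactly under (partial) localisation of the site energy
  (an atom `σ_e({0}) = m > 0` gives `J(t) ∼ m t²/2`) or sub-diffusive return.  It is implied by the route's
  announced `DyadicReturnBound` (Cesàro form `∫₀ᵗ S(0,s)ds ≤ C√t`, one integration) and a fortiori by any
  pointwise law `S(0,t) ≲ t^{-1/2}`; for positive-type `S(0,·)` it is EQUIVALENT in truth value to the crux
  (both say `σ_e([−ε,ε]) = O(√ε)`, Fejér kernel vs Poisson kernel) — but that equivalence is a theorem
  (Bochner + kernel comparison), not a rewording, and the time-domain / squared-norm form is the one that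
  dynamical tools produce (L²-decay of a local observable, dispersive or kinetic estimates, variance bounds
  for additive functionals `∫₀ᵗ g∘φ_s ds`).  Size: open problem (the crux's own why-might-fail).
* `stub_abelOfFejer` (PURE REAL ANALYSIS, provable now, size M): for ANY `f : ℝ → ℝ` with `e^{-νt}f`
  integrable on `(0,∞)` for all `ν > 0` (hence `f ∈ L¹_loc[0,∞)`) and `∫₀ᵗ(t−s)f(s)ds ≤ C t√t` for `t ≥ t₀`:
  `∃ C' ν₀ > 0, ∀ 0 < ν ≤ ν₀, ν∫₀^∞ e^{-νt} f ≤ C'√ν`.  Proof sketch: by Fubini (or two integrations by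
  parts, boundary terms killed with the hypothesis at `ν/2`), `ν∫₀^∞ e^{-νt} f(t) dt = ν³ ∫₀^∞ e^{-νt} J_f(t) dt`
  EXACTLY (check: `f ≡ 1 ↦ 1`, `f = cos ω· ↦ ν²/(ν²+ω²)`); split at `t₀`: `≤ ν³ t₀ sup_{[0,t₀]}|J_f| +
  max(C,0) ν³ Γ(5/2) ν^{-5/2} ≤ (t₀ M + (3√π/4) max(C,0)) √ν` for `ν ≤ 1`.  No sign condition on `f`, only
  the ONE-SIDED upper bound on `J_f` is used.  Leans on: `MeasureTheory.integral_prod` / `intervalIntegral`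
  FTC + `integral_Ioi_of_hasDerivAt_of_tendsto`, `Real.Gamma` integrals (`integral_rpow_mul_exp_neg_mul_Ioi`-type)
  or the cruder bound `t^{3/2} e^{-νt/2} ≤ (3/(eν))^{3/2}`.
* COMPOSITION `LocalEnergyHalfHoelder_of : stub₁-statement → stub₂-statement → LocalEnergyHalfHoelder`
  (sorry-free, closed): instantiate stub 1 at the guarded pair, feed `f := S 0` to stub 2.  The seam is
  short on purpose — all content sits in two NAMED stubs of different type (one dynamical, one Abelian);
  neither gives the crux or `FouriersLaw` by `exact? | simpa | aesop` (BC3 probes, planner folder `bc/`).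

Hardest stub: `stub_meanErgodicRate`.  Disproof used: none on file (`ledger crux ls stmt-AtomisticToContinuum-16008`:
no workfiles, no `Disproof.lean`, no `Negative/` lemma, 2026-08-17); `ledger negatives`: the two FouriersLaw
negatives (OddCorrectorDecay stmt-9139, DiluteCell FarFieldGaussianity stmt-12890) concern other objects.
Refuter route-review note (refuter-rreview-0816T17-3-0) respected: the full guarded prefix of the crux is
kept verbatim in stub 1 (no junk dynamics; Abel integral honest via the `IntegrableOn` hypothesis, which
stub 2 also consumes — it is what makes `f` locally integrable).
-/

noncomputable section

open MeasureTheory intervalIntegral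

namespace Summit.AtomisticToContinuum.FouriersLaw.Cruxes.LocalEnergyHalfHoelder

namespace Birth

/-! ## The two registered stubs -/

/-- **stub 1 — `stub_meanErgodicRate` (Fejér-mean return bound for the on-site energy; the dynamical heart).**
Under the hypotheses of `HoelderEscapeProfile.LocalEnergyHalfHoelder` VERBATIM (pinned chain `ω₂, lam, β > 0`,
`T > 0`, guarded pair `(μ, D)`, split-bond site energy `h`, `S x t = Cov_μ(h_0, h_x∘φ_t)`, Abel integrability of
`S 0`): there are `C` and `t₀ > 0` with `∫₀ᵗ (t − s)·S(0,s) ds ≤ C·(t·√t)` for all `t ≥ t₀` — equivalently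
`Var_μ((1/t)∫₀ᵗ h_0∘φ_s ds) ≤ 2C/√t`: the time-averaged local energy equilibrates in `L²` at the diffusive rate.
Weaker than the route's `DyadicReturnBound` (Cesàro form) and than any pointwise `t^{-1/2}` return law. -/
theorem stub_meanErgodicRate :
    ∀ ω₂ lam β γ : ℝ, 0 < ω₂ → 0 < lam → 0 < β → ∀ T : ℝ, 0 < T → ∀ μ : MeasureTheory.Measure Literature.MathematicalPhysics.KineticTheory.HeatConduction.ChainConfig, (Literature.MathematicalPhysics.KineticTheory.HeatConduction.pinnedChain ω₂ lam β γ).IsChainGibbsMeasure T μ → Literature.MathematicalPhysics.KineticTheory.HeatConduction.IsShiftInvariant μ → μ.map (fun σ : Literature.MathematicalPhysics.KineticTheory.HeatConduction.ChainConfig => fun x : ℤ => ((σ x).1, -(σ x).2)) = μ → ∀ D : Literature.MathematicalPhysics.KineticTheory.HeatConduction.InfiniteChainDynamics (Literature.MathematicalPhysics.KineticTheory.HeatConduction.pinnedChain ω₂ lam β γ), D.PreservesMeasure μ → (∀ t : ℝ, ∀ᵐ σ ∂μ, D.flow t (Literature.MathematicalPhysics.KineticTheory.HeatConduction.shift σ)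 = Literature.MathematicalPhysics.KineticTheory.HeatConduction.shift (D.flow t σ)) → ∀ h : Literature.MathematicalPhysics.KineticTheory.HeatConduction.ChainConfig → ℤ → ℝ, h = (fun (σ : Literature.MathematicalPhysics.KineticTheory.HeatConduction.ChainConfig) (x : ℤ) => (σ x).2 ^ 2 / 2 + (Literature.MathematicalPhysics.KineticTheory.HeatConduction.pinnedChain ω₂ lam β γ).U (σ x).1 + ((Literature.MathematicalPhysics.KineticTheory.HeatConduction.pinnedChain ω₂ lam β γ).V ((σ (x + 1)).1 - (σ x).1) + (Literature.MathematicalPhysics.KineticTheory.HeatConduction.pinnedChain ω₂ lam β γ).V ((σ x).1 - (σ (x - 1)).1)) / 2) → ∀ S : ℤ → ℝ → ℝ, S = (fun (x : ℤ) (t : ℝ) => ∫ σ, (h σ 0 - ∫ σ', h σ' 0 ∂μ) * (h (D.flow t σ) x - ∫ σ', h σ' 0 ∂μ) ∂μ) → (∀ ν : ℝ, 0 < ν → MeasureTheory.IntegrableOn (fun t : ℝ => Real.exp (-(ν * t)) * S 0 t) (Set.Ioi 0)) → ∃ C t₀ : ℝ, 0 < t₀ ∧ ∀ t : ℝ, t₀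 ≤ t → ∫ s in (0:ℝ)..t, (t - s) * S 0 s ≤ C * (t * Real.sqrt t) := by
  sorry

/-- **stub 2 — `stub_abelOfFejer` (second-order Abelian lemma, pure real analysis).**  For any
`f : ℝ → ℝ` such that `t ↦ e^{-νt} f t` is integrable on `(0,∞)` for every `ν > 0` and whose second primitive
obeys the one-sided bound `∫₀ᵗ (t − s) f(s) ds ≤ C·t√t` for `t ≥ t₀ > 0`, the Abel means satisfy
`ν∫₀^∞ e^{-νt} f(t) dt ≤ C'√ν` for `0 < ν ≤ ν₀`.  Key identity: `ν∫₀^∞e^{-νt}f = ν³∫₀^∞e^{-νt}(∫₀ᵗ(t−s)f(s)ds)dt`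
(Fubini: `∫_s^∞ e^{-νt}(t−s)dt = e^{-νs}/ν²`), then split at `t₀` and `ν³∫e^{-νt}t^{3/2}dt = Γ(5/2)√ν`. -/
theorem stub_abelOfFejer :
    ∀ (f : ℝ → ℝ) (C t₀ : ℝ), 0 < t₀ → (∀ ν : ℝ, 0 < ν → MeasureTheory.IntegrableOn (fun t : ℝ => Real.exp (-(ν * t)) * f t) (Set.Ioi 0)) → (∀ t : ℝ, t₀ ≤ t → ∫ s in (0:ℝ)..t, (t - s) * f s ≤ C * (t * Real.sqrt t)) → ∃ C' ν₀ : ℝ, 0 < ν₀ ∧ ∀ ν : ℝ, 0 < ν → ν ≤ ν₀ → ν * ∫ t in Set.Ioi (0:ℝ), Real.exp (-(ν * t)) * f t ≤ C' * Real.sqrt ν := by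
  sorry

/-! ## The composition (sorry-free) -/

/-- **Skeleton theorem — the crux `HoelderEscapeProfile.LocalEnergyHalfHoelder` BY NAME from the two
registered stubs**: `stub_meanErgodicRate`-statement → `stub_abelOfFejer`-statement → the crux.
Sorry-free and closed (axioms `propext`, `Classical.choice`, `Quot.sound` at most): instantiate the rate
bound at the guarded pair and apply the Abelian lemma to `f := S 0`. -/
theorem LocalEnergyHalfHoelder_of :
    (∀ ω₂ lam β γ : ℝ, 0 < ω₂ → 0 < lam → 0 < β → ∀ T : ℝ, 0 < T → ∀ μ : MeasureTheory.Measure Literature.MathematicalPhysics.KineticTheory.HeatConduction.ChainConfig, (Literature.MathematicalPhysics.KineticTheory.HeatConduction.pinnedChain ω₂ lam β γ).IsChainGibbsMeasure T μ → Literature.MathematicalPhysics.KineticTheory.HeatConduction.IsShiftInvariant μ → μ.map (fun σ : Literature.MathematicalPhysics.KineticTheory.HeatConduction.ChainConfig => fun x : ℤ => ((σ x).1, -(σ x).2)) = μ → ∀ D : Literature.MathematicalPhysics.KineticTheory.HeatConduction.InfiniteChainDynamics (Literature.MathematicalPhysics.KineticTheory.HeatConduction.pinnedChain ω₂ lam β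 γ), D.PreservesMeasure μ → (∀ t : ℝ, ∀ᵐ σ ∂μ, D.flow t (Literature.MathematicalPhysics.KineticTheory.HeatConduction.shift σ) = Literature.MathematicalPhysics.KineticTheory.HeatConduction.shift (D.flow t σ)) → ∀ h : Literature.MathematicalPhysics.KineticTheory.HeatConduction.ChainConfig → ℤ → ℝ, h = (fun (σ : Literature.MathematicalPhysics.KineticTheory.HeatConduction.ChainConfig) (x : ℤ) => (σ x).2 ^ 2 / 2 + (Literature.MathematicalPhysics.KineticTheory.HeatConduction.pinnedChain ω₂ lam β γ).U (σ x).1 + ((Literature.MathematicalPhysics.KineticTheory.HeatConduction.pinnedChain ω₂ lam β γ).V ((σ (x + 1)).1 - (σ x).1) + (Literature.MathematicalPhysics.KineticTheory.HeatConduction.pinnedChain ω₂ lam β γ).V ((σ x).1 - (σ (x - 1)).1)) / 2) → ∀ S : ℤ → ℝ → ℝ, S = (fun (x : ℤ) (t : ℝ) => ∫ σ, (h σ 0 - ∫ σ', h σ' 0 ∂μ) * (h (D.flow t σ) x - ∫ σ', h σ' 0 ∂μ) ∂μ) → (∀ ν : ℝ, 0 < ν → MeasureTheory.IntegrableOn (fun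 t : ℝ => Real.exp (-(ν * t)) * S 0 t) (Set.Ioi 0)) → ∃ C t₀ : ℝ, 0 < t₀ ∧ ∀ t : ℝ, t₀ ≤ t → ∫ s in (0:ℝ)..t, (t - s) * S 0 s ≤ C * (t * Real.sqrt t)) →
    (∀ (f : ℝ → ℝ) (C t₀ : ℝ), 0 < t₀ → (∀ ν : ℝ, 0 < ν → MeasureTheory.IntegrableOn (fun t : ℝ => Real.exp (-(ν * t)) * f t) (Set.Ioi 0)) → (∀ t : ℝ, t₀ ≤ t → ∫ s in (0:ℝ)..t, (t - s) * f s ≤ C * (t * Real.sqrt t)) → ∃ C' ν₀ : ℝ, 0 < ν₀ ∧ ∀ ν : ℝ, 0 < ν → ν ≤ ν₀ → ν * ∫ t in Set.Ioi (0:ℝ), Real.exp (-(ν * t)) * f t ≤ C' * Real.sqrt ν) →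
    _root_.Summit.AtomisticToContinuum.FouriersLaw.Theses.HoelderEscapeProfile.LocalEnergyHalfHoelder := by
  intro hRate hAbel ω₂ lam β γ hω hl hβ T hT μ hG hSI hRefl D hP hShift h hh S hS hInt
  obtain ⟨C, t₀, ht₀, hJ⟩ := hRate ω₂ lam β γ hω hl hβ T hT μ hG hSI hRefl D hP hShift h hh S hS hInt
  exact hAbel (S 0) C t₀ ht₀ hInt hJ

/-- The stubs plug into `LocalEnergyHalfHoelder_of` (type check of the cut; this declaration inherits the
two stub `sorry`s and contains none of its own). -/
theorem LocalEnergyHalfHoelder_skeleton :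
    _root_.Summit.AtomisticToContinuum.FouriersLaw.Theses.HoelderEscapeProfile.LocalEnergyHalfHoelder :=
  LocalEnergyHalfHoelder_of stub_meanErgodicRate stub_abelOfFejer

end Birth

end Summit.AtomisticToContinuum.FouriersLaw.Cruxes.LocalEnergyHalfHoelder

end
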